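import Literature.Analysis.FluidPDE.ZerothLaw
import Literature.Analysis.FluidPDE.LongTimeAverageNonneg
import HarnessLib

/-!
# Barrier (AnomalousDissipation): energy dissipation vanishes like `Re^{-1/2}` in steadily forced
two-dimensional turbulence
(D-0021 barrier catalogue for `Summits/AnomalousDissipation`; summit statement
`AnomalousDissipation := Literature.Turb.ZerothLaw`)

Alexakis–Doering, *Energy and enstrophy dissipation in steady state 2d turbulence*, Phys. Lett.
A 359 (2006) 652–657, §2 (time-independent forcing): for the 2-D Navier–Stokes equations on a
periodic box driven by a smooth, mean-zero, divergence-free steady body force of shape `Φ` and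
wavenumber `k_f`, the long-time averaged energy dissipation rate `ε = ν⟨|∇u|²⟩ = ν⟨ω²⟩` obeys
`ε ≤ k_f U³ Re^{-1/2} (C₁ + C₂ Re⁻¹)^{1/2}`, `Re = U/(k_f ν)`, `U = ⟨|u|²⟩^{1/2}`, with `C₁, C₂`
depending only on the shape of the force (op. cit. §2: `χ = ⟨ωφ⟩ ≤ k_f² U F`,
`F ≤` shape constants `× (U² k_f + ν U k_f²)`, and `ε² = ν²⟨ω²⟩² ≤ ν U² χ`). Hence, at bounded
`U`, `ε = O(ν^{1/2}) → 0` as `ν → 0`: "the dissipation rates of two dimensional turbulence fall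
somewhere between laminar scalings and the rates for three dimensional turbulence" and
`β = ε/(k_f U³) ≲ Re^{-1/2}` (op. cit. §1–2) — the two-dimensional analogue of the zeroth law in
the summit's normalisation (fixed smooth steady force, bounded mean energy, dissipation bounded
below) fails.

## What is vendored

* `AlexakisDoering2006_energyDissipationBound` — the displayed bound of §2 in the rendering of
  the accepted companion fact `Literature.Analysis.FluidPDE.alexakis_doering_enstrophy_bound`
  (`Literature.Analysis.FluidPDE.ZerothLaw`): unit torus `T² = UnitAddTorus (Fin 2)`, force
  `F Φ(x/ℓ)` with `ℓ = 1/n` (`Literature.Turb.ForcingShape.force Φ n F`, so `k_f ∝ n` and the shape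
  constants absorb the proportionality factor), global Leray–Hopf solutions (unique and smooth
  for `t > 0` in 2-D), *smooth* datum, `U = Turb.rmsVelocity longTimeAvgSup u > 0`, and
  `ε = Turb.meanDissipation ν u` (limsup of Cesàro means, spectral gradient). The bound is written
  as `ε ≤ (ν U² · alexakisDoeringRHS C₁ C₂ ν U ℓ)^{1/2}` (the printed `ε² ≤ ν U² χ` composed with
  the `χ`-bound right-hand side `Literature.Analysis.FluidPDE.alexakisDoeringRHS` of the accepted enstrophy fact),
  which equals `(n³ (C₁ ν U⁵ + C₂ ν² n U⁴))^{1/2}` (`nu_mul_sq_mul_alexakisDoeringRHS`) and, for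
  `U > 0`, the printed `k_f U³ Re^{-1/2}(C₁ + C₂ Re⁻¹)^{1/2}` with `k_f ↦ n`. *Averages:* the source assumes the
  long-time limits exist ("The limit in the time average is assumed to exist for all the
  quantities of interest", §2); the limsup rendering follows the accepted enstrophy fact.
* `AlexakisDoering2006_energyDissipationBound.no_twoDimensional_zerothLaw` — proved corollary:
  along any family `ν_j → 0` of such flows with `0 < U_j ≤ Ū` the mean dissipation tends to
  `0`. The barrier block sits on the named fact.

## Barrier audit (refuter, 2026-08-15): CONFIRMED, scope in print broader than vendored

* The named fact is a THEOREM of the tree (`AlexakisDoering2006_energyDissipationBound_holds`,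
  `Literature.Barriers.AnomalousDissipation.TwoDimensionalEnergyDissipationProofs`; axioms
  `propext`, `Classical.choice`, `Quot.sound`), so the barrier cannot be refuted; the `blocks:`
  clause (the bounded-energy `d = 2` analogue of the zeroth law, and the planar velocity of an
  `x₃`-invariant flow) is exactly what the statement delivers, and the third (transported)
  velocity component is explicitly outside it.
* Under-claims of the vendored rendering (information for users, no statement change): the
  smooth-datum hypothesis (any `L²` datum gives a smooth slice at positive time and the
  `limsup` means are shift invariant), the hypothesis `0 < U` (`U = 0` forces `ε ≤ |F| U = 0`
  by the Leray–Hopf energy inequality), and the steady single-scale form `F Φ(x/ℓ)` of the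
  force: the printed argument also covers smooth *time-dependent* forces (op. cit. §3,
  `β ≤ Re^{-1/2}(τ + C₃ + Re⁻¹)^{1/2}`, `τ = Ω_f/(k_f U)`; §5: "no residual dissipation … at fixed
  `U`, `L`, `k_f` and `Ω_f`"), is uniform in the amplitude `F` (so `ν`-dependent amplitudes are
  covered verbatim), and the two steps `χ ≤ U⟨‖Δf‖₂²⟩^{1/2}` (VBI) and `ε² ≤ ν U² χ` (trickI)
  alone give `ε² ≤ ν U³ ⟨‖Δf‖₂²⟩^{1/2}` for every force bounded in time-mean `H²`, and
  `ε² ≤ 2ν U³⟨‖Δf‖₂²⟩^{1/2} + 2U²⟨‖g^ν‖₂²⟩` for `f + g^ν` with `g^ν → 0` in time-mean `L²`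
  (two-line consequence recorded by the audit) — so `ν`-dependent forces converging in `L²` to an
  `H²` force do not evade it either, consistent with every printed Navier–Stokes anomaly being
  `2½`-dimensional with the anomaly in the transported component.
* Forcing regularity is the one printed evasion of the *technique*: for `f ∈ Ḣ^s`, `0 ≤ s < 2`,
  the decay weakens to `εℓ/U³ ≲ Re^{-s/(2+s)}`, disappears at `s = 0` and the bound grows for
  `-1 ≤ s < 0` (Mukherjee–Gibbon–Vincenzi 2025, Table I, eq. (38), §4) — irrelevant to the summit,
  whose force is smooth, but recorded under `evasions_known:`.
* Single-shell forcing (`-Δf = k_f² f`, any time dependence; op. cit. §4): `ε ≤ ν k_f² U²` and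
  `χ ≤ ν k_f⁴ U²`, i.e. mean enstrophy `≤ k_f² U²` and mean palinstrophy `≤ k_f⁴ U²` uniformly in
  `ν` — not vendored; it makes the planar velocity of a single-shell-forced `2½`-dimensional flow
  bounded in time-mean `H²` uniformly in `ν` (recorded under `scope_caveats:` for the planners of
  `x₃`-invariant routes).

## References

* A. Alexakis, C. R. Doering, Phys. Lett. A 359 (2006), §1, §2 (time-independent forcing), §3
  (time-dependent forcing), §4 (monochromatic and constant-flux forcing), §5 (discussion)
  (arXiv:physics/0605090).
* R. Mukherjee, J. D. Gibbon, D. Vincenzi, *Estimates for the 2D Navier–Stokes equations: the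
  effects of forcing*, arXiv:2512.15188 (2025), Table I, eq. (38), §4.
* P. Constantin, A. Tarfulea, V. Vicol, Arch. Ration. Mech. Anal. 212 (2014), §1 p. 3
  (arXiv:1305.7089): bounded-energy stationary families of the periodic forced 2-D equations are
  an open problem.
* A. Cheskidov, arXiv:2311.04182 (2023), §1 p. 6 ("dissipation anomaly is not possible in
  two-dimensional flows") and §3 (the `2 + ½`-dimensional architecture of the long-time anomaly).
* P. Constantin, F. Ramos, Comm. Math. Phys. 275 (2007), Thm. 1 (damped–driven 2-D: accepted
  `Literature.Analysis.FluidPDE.constantin_ramos_2d`).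
* P. Constantin, Bull. AMS 44 (2007), §3.2 (2-D inverse cascade discussion).
-/

open MeasureTheory Set Filter Topology
open scoped ENNReal NNReal

noncomputable section

namespace Literature.Barriers.AnomalousDissipation

open Literature.Analysis.FluidPDE

/-- The flat two-torus `T² = (ℝ/ℤ)²` (local notation). -/
local notation "𝕋²" => UnitAddTorus (Fin 2)
/-- Velocity values on `T²` (local notation). -/
local notation "E²" => EuclideanSpace ℝ (Fin 2)

/-- **Alexakis–Doering energy dissipation bound for steady-state 2-D turbulence**
(Alexakis–Doering, Phys. Lett. A 359 (2006), §2, final display: `β ≤ Re^{-1/2}(C₁ + C₂ Re⁻¹)^{1/2}`; announced in §1).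
Fix a forcing shape `Φ` on `T²` (smooth, divergence free, mean zero, `‖Φ‖₂ = 1`). There are
constants `C₁, C₂ > 0` depending only on `Φ` such that for every viscosity `ν > 0`, forcing
scale `ℓ = 1/n` (`n ∈ ℕ⁺`), amplitude `F`, every smooth datum `u₀` and every global Leray–Hopf
solution `u` of the 2-D Navier–Stokes equations on `T²` driven by the steady force
`f(x) = F Φ(x/ℓ)`, with `U = ⟨‖u‖₂²⟩^{1/2} > 0` (limsup long-time averages), the mean energy
dissipation rate `ε = ⟨ν‖∇u‖₂²⟩` satisfies
`ε ≤ (ν U² (C₁ U³/ℓ³ + C₂ ν U²/ℓ⁴))^{1/2}` — the printed chain `ε² ≤ ν U² χ`,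
`χ ≤ (C₁ + C₂Re⁻¹) k_f³U³` with the accepted `Turb.alexakisDoeringRHS C₁ C₂ ν U ℓ` — i.e.
`ε ≤ k_f U³ Re^{-1/2}(C₁ + C₂ Re⁻¹)^{1/2}` with `k_f = n`, `Re = U/(n ν)`
(`nu_mul_sq_mul_alexakisDoeringRHS`). In particular `β = ε/(k_f U³) ≲ Re^{-1/2} → 0` at
bounded `U`.
*Averages:* printed for long-time limits assumed to exist; limsup rendering as in the accepted
`Turb.alexakis_doering_enstrophy_bound`.

BARRIER (D-0021):
- technique_class: two-dimensional planar-reduction 2d-navier-stokes x3-invariant-velocity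
- blocks: the `d = 2` analogue of `Literature.Turb.ZerothLaw` (= `AnomalousDissipation`) — steady smooth force `F Φ(x/ℓ)` on `T²`, `ν_j → 0`, Leray–Hopf solutions with bounded mean energy (and `U_j > 0`) and mean dissipation `≥ ε > 0` — which is refuted by `ε ≤ k_f U³ Re^{-1/2}(C₁ + C₂Re⁻¹)^{1/2} → 0`: "there is no residual dissipation in the vanishing viscosity limit defined by `Re → ∞` at fixed `U`, `L`, `k_f`" [cite: AlexakisDoering2006PLA, §2, final display for β, and §5]; the fact instantiates verbatim on the planar velocity of an `x₃`-invariant (`2½`-dimensional) flow whenever that planar velocity is itself a global Leray–Hopf solution of the 2-D system driven by such a force `F Φ(x/ℓ)` (the setting of route TwoAndHalfD), bounding its mean energy dissipation by the same `O(Re^{-1/2})`; with linear damping the long-time dissipation also vanishes for steady Lipschitz forces [cite: ConstantinRamos2007, Thm. 1] (`Literature.Analysis.FluidPDE.constantin_ramos_2d`).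
- because: in 2-D the enstrophy balance bounds the enstrophy dissipation, `χ = ν⟨|∇ω|²⟩ = ⟨ωφ⟩ ≤ k_f² U F` [cite: AlexakisDoering2006PLA, §2, enstrophy production–dissipation balance], testing the momentum equation against a smooth field of the shape of `f` bounds the amplitude, `F ≤` shape constants `× (k_f U² + ν k_f² U)` [cite: AlexakisDoering2006PLA, §2, test-field estimate eliminating F], and `⟨ω²⟩² = ⟨u·∇×(k̂ω)⟩² ≤ ⟨|u|²⟩⟨|∇ω|²⟩` gives `ε² = ν²⟨ω²⟩² ≤ ν U² χ` [cite: AlexakisDoering2006PLA, §2, final step]; absence of vortex stretching is what makes `χ` a priori bounded in 2-D [cite: DrivasEyink2019, §1 after Lemma 1].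
- evasions_known: leave two dimensions through the third velocity component: `2½`-dimensional (`x₃`-invariant, three-component) flows whose third component is a scalar transported by the planar flow dissipate anomalously on a finite window, with a `ν`-dependent family of forces uniformly bounded in `C⁰_t C^α_x`, `α < 1` [cite: BrueDeLellis2023, Thm. 1.1 and §3] (`Literature.Analysis.FluidPDE.brue_deLellis_anomalous_dissipation`); the same `2½`-dimensional strategy with a `ν`-dependent family of forces `F_ν` yields Onsager-critical families uniformly in `L³_t C^α_x`, `α < 1/3` — "We use the same strategy as in [BDL22] … and consider a `2+½`-dimensional Navier-Stokes solution, for which the evolution decouples into a forced 2d-Navier-Stokes system and a scalar advection-diffusion equation … The third component … will exhibit anomalous dissipation" [cite: BCCDS2024, Thm. 1.1 and §2] (`Literature.Analysis.FluidPDE.bccds_onsager_critical`); in both the anomalous dissipation is carried by the transported third component, not by the planar velocity, and the same holds for the only long-time-average anomaly in print, whose building blocks are again `2 + ½`-dimensional Euler/Navier–Stokes solutions `u = (v, ρ)` with a planar field `v` mixing the third component `ρ` [cite: Cheskidov2023, §3 (Perfect mixing), first paragraph, and Thm. 1.3] (`Literature.Barriers.AnomalousDissipation.Cheskidov2023_thm13_not_forceRobustNoAnomaly`);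 this is forced, not a choice: the bound is uniform in the amplitude `F`, and the two printed steps `χ ≤ U⟨‖Δf‖₂²⟩^{1/2}`, `ε² ≤ νU²χ` [cite: AlexakisDoering2006PLA, §2, (VBI) and (trickI); §3 for time-dependent f] give `ε² ≤ νU³⟨‖Δf‖₂²⟩^{1/2}` for every (time- or `ν`-dependent) force bounded in time-mean `H²` and `ε² ≤ 2νU³⟨‖Δf‖₂²⟩^{1/2} + 2U²⟨‖g^ν‖₂²⟩` for forces `f + g^ν` with `g^ν → 0` in time-mean `L²` (audit remark, two lines from the cited steps), so a *planar* anomaly at bounded energy needs forces unbounded in time-mean `H²` that do not converge in `L²`; ROUGH forcing is the one printed evasion of the technique: for `f ∈ Ḣ^s(T²)`, `0 ≤ s < 2`, only `εℓ/U³ ≲ Re^{-s/(2+s)}` survives, with no decay at `s = 0` and a bound growing like `Re^{-s/(s+2)}` for `-1 ≤ s < 0` — "for `-1 < s < 0`, the time-averaged energy dissipation rate can increase with `Re`, similar to what is found in three dimensions for non-square-integrable forcing" [cite: MukherjeeGibbonVincenzi2025, Table I, eq. (38) and §4] (outside the summit, whose force is smooth); in 2-D only *enstrophy* may cascade forward,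 `χ ≲ k_f³U³` uniformly in `Re` [cite: AlexakisDoering2006PLA, §2, bound for γ, and §5] (`Literature.Analysis.FluidPDE.alexakis_doering_enstrophy_bound`).
- scope_caveats: `d = 2`, periodic (no boundary: wall-bounded 2-D flows have a boundary enstrophy flux and are not addressed), and only §2 (time-independent forcing) is vendored — NOT vendored but printed, hence also closed and not to be read as open: smooth time-dependent (e.g. time-periodic, `ν`-independent) forces, `β ≤ Re^{-1/2}(τ + C₃ + Re⁻¹)^{1/2}` with `τ = Ω_f/(k_fU)`, `Ω_f² = ⟨|∂_t f|²⟩/⟨|f|²⟩`, so that "there is no residual dissipation in the vanishing viscosity limit defined by `Re → ∞` at fixed `U`, `L`, `k_f` and `Ω_f`" (the `d = 2` analogue of `Literature.Analysis.FluidPDE.ZerothLawTimePeriodic` fails as well) [cite: AlexakisDoering2006PLA, §3, bounds (VboundT) and for β, and §5, first paragraph], with the same form of bounds for time-dependent `Ḣ^s` forcing [cite: MukherjeeGibbonVincenzi2025, §4, last paragraph]; and the sharper single-shell case `-Δf = k_f²f` (any time dependence): `χ = k_f²ε`, `ε ≤ νk_f²U²`, `χ ≤ νk_f⁴U²` [cite: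 AlexakisDoering2006PLA, §4, (EPDBmono) and the two displayed bounds after (trick2)], i.e. mean enstrophy `⟨ω²⟩ ≤ k_f²U²` and mean palinstrophy `⟨‖∇ω‖₂²⟩ ≤ k_f⁴U²` uniformly in `ν`, which makes the planar velocity of a single-shell-forced `x₃`-invariant flow bounded in time-mean `H²` uniformly in `ν` (relevant to, but not a statement about, the scalar it transports); likewise constant-flux forcing [cite: AlexakisDoering2006PLA, §4]; the force is the `ν`-independent rescaling `F Φ(x/ℓ)`, `ℓ = 1/n`, of a fixed smooth shape on the unit torus (`Literature.Analysis.FluidPDE.ForcingShape.force`), the datum is smooth, and the averages are `limsup` long-time means whereas the source assumes the limits exist ("The limit in the time average is assumed to exist", §2); the fact and the proved corollary carry the hypothesis `0 < U` (resp. `0 < U_j ≤ Ū`), so the bounded-energy `d = 2` analogue of `Literature.Turb.ZerothLaw` named under `blocks:` is derived only for families with `U_j > 0` (an index with `U_j = 0` is not covered by the vendored statement); finite-window anomalies and time- or `ν`-dependent forces are outside the statement; the bound concerns *energy* dissipation of the planar velocity — enstrophy dissipation `χ` need not vanish [cite: AlexakisDoering2006PLA, §2, bound for γ, and §5], and nothing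 is printed about scalars or a third velocity component transported by the planar flow.
- status: established (theorem; derivation printed under the standing assumption that the long-time averages exist) [cite: AlexakisDoering2006PLA, §2]; discharged in the tree for the `limsup` rendering (`AlexakisDoering2006_energyDissipationBound_holds`, `Literature.Barriers.AnomalousDissipation.TwoDimensionalEnergyDissipationProofs`); barrier audit 2026-08-15: confirmed (see the module docstring). -/
def AlexakisDoering2006_energyDissipationBound : Prop :=
  ∀ (Φ : ForcingShape (Fin 2)),
    ∃ C₁ C₂ : ℝ, 0 < C₁ ∧ 0 < C₂ ∧
      ∀ ν : ℝ, 0 < ν → ∀ n : ℕ, 0 < n → ∀ (F : ℝ) (u₀ : 𝕋² → E²) (u : ℝ → 𝕋² → E²),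
        Literature.Analysis.FunctionSpaces.Torus.IsSmooth u₀ →
        Torus.IsGlobalLerayHopf ν (fun _ => Φ.force n F) u₀ u →
        0 < rmsVelocity longTimeAvgSup u →
          meanDissipation ν u ≤
            Real.sqrt (ν * rmsVelocity longTimeAvgSup u ^ 2 *
              alexakisDoeringRHS C₁ C₂ ν (rmsVelocity longTimeAvgSup u) ((n : ℝ)⁻¹))

/-- The squared-out right-hand side: `ν U² · (C₁ U³/ℓ³ + C₂ ν U²/ℓ⁴) = n³ (C₁ ν U⁵ + C₂ ν² n U⁴)`
for `ℓ = 1/n`, `n ≠ 0` — i.e. `(ν U² χ_bound)^{1/2} = k_f U³ Re^{-1/2}(C₁ + C₂ Re⁻¹)^{1/2}` with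
`k_f = n`, `Re = U/(nν)` (Alexakis–Doering 2006, §2, `ε² ≤ ν U² χ`). [cite: AlexakisDoering2006PLA, §2] -/
theorem nu_mul_sq_mul_alexakisDoeringRHS (C₁ C₂ ν U : ℝ) {n : ℝ} (hn : n ≠ 0) :
    ν * U ^ 2 * alexakisDoeringRHS C₁ C₂ ν U n⁻¹ =
      n ^ 3 * (C₁ * ν * U ^ 5 + C₂ * ν ^ 2 * n * U ^ 4) := by
  unfold alexakisDoeringRHS
  rw [inv_pow, inv_pow]
  field_simp

/-- **No two-dimensional zeroth law** (corollary of the Alexakis–Doering bound, op. cit. §1: `β ≲ Re^{-1/2}`). Given the bound, for every forcing shape `Φ` on `T²`, scale `ℓ = 1/n`,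
amplitude `F`, viscosities `ν_j > 0` with `ν_j → 0`, smooth data `u₀,ⱼ` and global Leray–Hopf
solutions `u_j` driven by `F Φ(x/ℓ)` whose r.m.s. velocities satisfy `0 < U_j ≤ Ū`, the mean
energy dissipation rates tend to zero: `⟨ν_j‖∇u_j‖₂²⟩ → 0`. Proved from the named fact.
[cite: AlexakisDoering2006PLA, §1 and §2] -/
theorem AlexakisDoering2006_energyDissipationBound.no_twoDimensional_zerothLaw
    (h : AlexakisDoering2006_energyDissipationBound) (Φ : ForcingShape (Fin 2)) {n : ℕ}
    (hn : 0 < n) (F : ℝ) (ν : ℕ → ℝ) (hν : ∀ j, 0 < ν j) (hν₀ : Tendsto ν atTop (𝓝 0))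
    (u₀ : ℕ → 𝕋² → E²) (u : ℕ → ℝ → 𝕋² → E²) (hu₀ : ∀ j, Literature.Analysis.FunctionSpaces.Torus.IsSmooth (u₀ j))
    (hu : ∀ j, Torus.IsGlobalLerayHopf (ν j) (fun _ => Φ.force n F) (u₀ j) (u j))
    {Ubar : ℝ} (hU : ∀ j, 0 < rmsVelocity longTimeAvgSup (u j) ∧
      rmsVelocity longTimeAvgSup (u j) ≤ Ubar) :
    Tendsto (fun j => meanDissipation (ν j) (u j)) atTop (𝓝 0) := by
  obtain ⟨C₁, C₂, hC₁, hC₂, hb⟩ := h Φ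
  -- abbreviate the r.m.s. velocities
  set U : ℕ → ℝ := fun j => rmsVelocity longTimeAvgSup (u j) with hUdef
  have hUpos : ∀ j, 0 < U j := fun j => (hU j).1
  have hUle : ∀ j, U j ≤ Ubar := fun j => (hU j).2
  have hUbar : 0 < Ubar := (hUpos 0).trans_le (hUle 0)
  -- the dominating sequence
  let B : ℕ → ℝ := fun j =>
    Real.sqrt ((n : ℝ) ^ 3 * (C₁ * ν j * Ubar ^ 5 + C₂ * ν j ^ 2 * n * Ubar ^ 4))
  have hB : Tendsto B atTop (𝓝 0) := by
    have h1 : Tendsto (fun j => (n : ℝ) ^ 3 * (C₁ * ν j * Ubar ^ 5 + C₂ * ν j ^ 2 * n * Ubar ^ 4))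
        atTop (𝓝 ((n : ℝ) ^ 3 * (C₁ * 0 * Ubar ^ 5 + C₂ * 0 ^ 2 * n * Ubar ^ 4))) := by
      have hc : Continuous fun x : ℝ => (n : ℝ) ^ 3 * (C₁ * x * Ubar ^ 5 + C₂ * x ^ 2 * n * Ubar ^ 4) := by
        fun_prop
      exact (hc.tendsto 0).comp hν₀
    simp only [mul_zero, zero_mul, ne_eq, OfNat.ofNat_ne_zero, not_false_eq_true, zero_pow,
      add_zero] at h1
    have h2 := (Real.continuous_sqrt.tendsto 0).comp h1
    rw [Real.sqrt_zero] at h2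
    exact h2
  refine squeeze_zero (fun j => ?_) (fun j => ?_) hB
  · -- nonnegativity of the mean dissipation (`Literature.Analysis.FluidPDE.meanDissipation_nonneg`, junk included)
    exact meanDissipation_nonneg (hν j).le (u j)
  · have hn' : (n : ℝ) ≠ 0 := Nat.cast_ne_zero.mpr hn.ne'
    calc meanDissipation (ν j) (u j)
        ≤ Real.sqrt (ν j * U j ^ 2 * alexakisDoeringRHS C₁ C₂ (ν j) (U j) ((n : ℝ)⁻¹)) :=
          hb (ν j) (hν j) n hn F (u₀ j) (u j) (hu₀ j) (hu j) (hUpos j)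
      _ = Real.sqrt ((n : ℝ) ^ 3 * (C₁ * ν j * U j ^ 5 + C₂ * ν j ^ 2 * n * U j ^ 4)) := by
          rw [nu_mul_sq_mul_alexakisDoeringRHS C₁ C₂ (ν j) (U j) hn']
      _ ≤ B j := by
          apply Real.sqrt_le_sqrt
          have hνj := (hν j).le
          have hUj := (hUpos j).le
          gcongr
          · exact hUle j
          · exact hUle j

end Literature.Barriers.AnomalousDissipation

end
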